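import Summits.Ventures.PercRepro.MSRMStarConjV
import Summits.Ventures.PercRepro.ThetaTwoPairsV2

/-!
# (Θ) and CYCLE-MS′ whenever some type has at most two pairs — unconditional

Dossier proofs/MINE1-theoremS.md, Addendum 65 (Consequences). With Conjecture V a theorem
(`conjV`, MSRMStarConjV.lean), every statement of the cell proved «modulo V» becomes
unconditional by one application: Conjecture V-2 (`conjV2`), the set-world (Θ) with at most two
pairs of the middle type (`theta_card_le_of_card_le_two`) or of some type
(`theta_card_le_of_some_card_le_two`, ThetaTwoPairs.lean), and CYCLE-MS′ in the typed form of
record whenever some type has at most two pairs (`PercRepro.cycleMS_of_some_card_le_two`,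
ThetaBridge.lean).
-/

namespace PercRepro

open Finset
open scoped FinsetFamily

namespace MSTight

variable {α : Type*} [DecidableEq α] [Fintype α]

/-- **Conjecture V-2** holds (ThetaTwoPairsV2.lean): Conjecture V implies it. -/
theorem conjV2 : ConjV2 α := conjV2_of_conjV (conjV α)

/-- **(Θ) with at most two pairs of the middle type**, unconditional. -/
theorem theta_card_le_of_card_le_two {A B C : Finset (Finset α)} (h : ThetaValid A B C)
    (hB : B.card ≤ 2) : A.card + B.card + C.card ≤ (thetaD A B C).card :=
  theta_card_le_of_card_le_two_of_conjV (conjV α) h hB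

/-- **(Θ) whenever some type has at most two pairs**, unconditional. -/
theorem theta_card_le_of_some_card_le_two {A B C : Finset (Finset α)} (h : ThetaValid A B C)
    (hsmall : A.card ≤ 2 ∨ B.card ≤ 2 ∨ C.card ≤ 2) :
    A.card + B.card + C.card ≤ (thetaD A B C).card :=
  theta_card_le_of_some_card_le_two_of_conjV (conjV α) h hsmall

end MSTight

variable {S : Type} [Fintype S] [DecidableEq S]

/-- **CYCLE-MS′ whenever some type has at most two pairs** (the cell's typed form of record),
unconditional. -/
theorem cycleMS_of_some_card_le_two (A B C : Finset (Config S))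
    (hd : [A, B, C, famCompl A, famCompl B, famCompl C].Pairwise Disjoint)
    (hsmall : A.card ≤ 2 ∨ B.card ≤ 2 ∨ C.card ≤ 2) :
    A.card + B.card + C.card ≤ (famD A B C).card :=
  cycleMS_of_some_card_le_two_of_conjV (MSTight.conjV S) A B C hd hsmall

end PercRepro
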